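import Mathlib
import Summits.KontsevichZagierPeriods.Zeta5Search.SecondOrderAssembly
import HarnessLib

/-!
# ζ(5) search — THEOREM A‴ (`SecondOrder.LawA3`, gen-2 g10) IS A THEOREM: `v_p(Cas_j(b)) ≥ 6 − 2M`

Cell `pub-zeta5` (HONEST FRAMING: systematic search; no irrationality claim unless certified), typer seat generation 11.
Discharges BY NAME `SecondOrder.LawA3` of `Zeta5Search/SecondOrderDigit.lean` (REPORT-gen2-g10 §3, THEOREM A‴ one-type form; exact
random census 4,016 instances, X-ray cells 95 instances): window prime `5 ≤ p ≤ b₀ < p² − 2`, `M ≥ 6` even, every multipole class of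
exponent `≥ −M` and the classes of exponent `−M` non-self-conjugate of ONE palindromic type `T`, every single-pole class with `ν ≥ −M+1`,
every pole class with `ν = −M+1` a single raise of `T` or the odd-centre class of type `T` ⟹ `v_p(Cas_j(b)) ≥ 6 − 2M` (= `casLB + 3`).
Proof: §1 the class hypotheses TRANSPORT from `b` to `b + e_j` (REPORT §2.3: the two moved points raise one conjugate pair of classes;
a hit deep class becomes a raise of `T`; tameness persists); §2 `aggregate` (file `SecondOrderAssembly`) for `b` and `b + e_j` gives
`W/(−p)^{m+3} ≡ −pX`, `V/(−p)^m ≡ −pY` with `(X, Y) ≡ α τ(T)` and `(X⁺, Y⁺) ≡ α⁺ τ(T)` — the SAME direction since `τ` is read off the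
list `T` — whence `W⁺V − WV⁺ = (−p)^{2m+3}·(p²(X⁺Y − XY⁺) + O(p³))` and `X⁺Y − XY⁺ ≡ α⁺α(τ_Wτ_V − τ_Vτ_W) = 0`.
`p`-adic valuations of rational numbers; nothing here bears on irrationality.
-/

noncomputable section

open Finset PowerSeries

namespace Summit.KontsevichZagierPeriods.Zeta5Search.SecondOrder

open Summit.KontsevichZagierPeriods.Zeta5Search.DualSeries (InBox)
open Summit.KontsevichZagierPeriods.Zeta5Search.WedgeDictionary (coeffW coeffV)
open Summit.KontsevichZagierPeriods.Zeta5Search.CasoratianValuation (InPolytope shift casoratian)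
open Summit.KontsevichZagierPeriods.Zeta5Search.ClusterValuation
open Summit.KontsevichZagierPeriods.Zeta5Search.PadicSeries
open Summit.KontsevichZagierPeriods.Zeta5Search.BigPrime (shift_zero)
open Summit.KontsevichZagierPeriods.Zeta5Search.CellKit (two_mul_le_of_shift classExp_shift_eq unhit_of_classExp_eq netExp_shift_of_unhit)
open Literature.NumberTheory.Transcendental.BallRivoal (harm)

variable {p : ℕ} [hp : Fact p.Prime]

/-! ## §1 Transport of the class hypotheses to `b + e_j` -/

section Transport

variable (b : ℕ → ℤ) {j : ℕ} (hb : InPolytope b) (hb' : InPolytope (shift b j)) (hj1 : 1 ≤ j) (hj7 : j ≤ 7)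
include hb hb' hj1 hj7

omit hp in
/-- **Tameness persists**: a single-pole class of `b` that is still a pole class of `b + e_j` and was tame stays tame. -/
theorem tameSingle_shift {x : ℕ} (h1 : classPoleCount b p x = 1) (h1' : 1 ≤ classPoleCount (shift b j) p x)
    (ht : tameSingle b p x = true) : tameSingle (shift b j) p x = true := by
  have h2 := two_mul_le_of_shift b hj1 hj7 hb'
  unfold tameSingle at ht ⊢
  rw [decide_eq_true_eq] at ht ⊢
  obtain ⟨q, hq, hqneg, hq'⟩ := ht
  -- the pole of `b + e_j` in the class is a pole of `b`, hence `= q`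
  obtain ⟨q', hq'mem⟩ := card_pos.1 (show 0 < ((classSet (shift b j) p x).filter fun s => netExp (shift b j) s < 0).card from h1')
  obtain ⟨hq'c, hq'neg⟩ := mem_filter.1 hq'mem
  rw [classSet_shift b hj1] at hq'c
  have hq'negb : netExp b q' < 0 := lt_of_le_of_lt (netExp_shift_ge b hb.1 hj1 q') hq'neg
  have hqq : q' = q := by
    by_contra hne
    have : 2 ≤ classPoleCount b p x := by
      unfold classPoleCount
      refine Finset.one_lt_card.2 ⟨q', mem_filter.2 ⟨hq'c, hq'negb⟩, q, mem_filter.2 ⟨hq, hqneg⟩, hne⟩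
    omega
  subst hqq
  refine ⟨q', by rwa [classSet_shift b hj1], hq'neg, ?_⟩
  rcases hq' with hlt | hall
  · exact Or.inl hlt
  · refine Or.inr fun s hs hsq => ?_
    rw [classSet_shift b hj1] at hs
    exact lt_of_lt_of_le (hall s hs hsq) (netExp_shift_ge b hb.1 hj1 s)

/-- An unhit class keeps its type list. -/
theorem classTypeList_shift_of_unhit {x : ℕ} (heq : classExp (shift b j) p x = classExp b p x) (hxn : x ≤ (b 0).toNat) :
    classTypeList (shift b j) p x = classTypeList b p x := by
  obtain ⟨h1, h2⟩ := unhit_of_classExp_eq b hb hj1 hj7 hb' heq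
  have htop : topLevel (shift b j) p x = topLevel b p x := by unfold topLevel; rw [shift_zero b hj1]
  unfold classTypeList
  rw [htop]
  refine List.map_congr_left fun ℓ hℓ => ?_
  have hℓ' := List.mem_range.1 hℓ
  obtain ⟨hL, -⟩ := level_bounds' (p := p) b hxn
  refine netExp_shift_of_unhit b hb hj1 hj7 hb' h1 h2 ?_
  refine mem_filter.2 ⟨mem_range.2 ?_, by rw [Nat.add_mul_mod_self_right]⟩
  have : ℓ * p ≤ topLevel b p x * p := Nat.mul_le_mul_right p (by omega)
  omega

variable (hp5 : 5 ≤ p) (hpn : (p : ℤ) ≤ b 0) {M : ℕ} (hM : 6 ≤ M) {T : List ℤ}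
  (H1 : ∀ x ∈ multipoleClasses b p, -(M : ℤ) ≤ classExp b p x)
  (H2 : ∀ y, y < p → classPoleCount b p y = 1 → -(M : ℤ) + 1 ≤ classNu b p y)
  (H3 : ∀ x ∈ multipoleClasses b p, classExp b p x = -(M : ℤ) → ¬ CentreIn b p x ∧ classTypeList b p x = T)
  (H4 : ∀ y, y < p → 1 ≤ classPoleCount b p y → classNu b p y = -(M : ℤ) + 1 →
    isRaise T (classTypeList b p y) = true ∨ (¬ (2 : ℤ) ∣ b 0 ∧ CentreIn b p y ∧ classTypeList b p y = T))
include hp5 hpn hM H1 H2 H3 H4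

omit hp hb' hj7 hp5 hpn hM H2 H3 H4 in
/-- **H1 transports.** -/
theorem H1_shift : ∀ x ∈ multipoleClasses (shift b j) p, -(M : ℤ) ≤ classExp (shift b j) p x := by
  intro x hx
  obtain ⟨hxr, h2⟩ := mem_filter.1 hx
  have h2b : 2 ≤ classPoleCount b p x := le_trans h2 (classPoleCount_shift_le b hb.1 hj1 p x)
  exact (H1 x (mem_filter.2 ⟨hxr, h2b⟩)).trans (classExp_shift_ge b hb.1 hj1 p x)

omit hp hp5 hpn H3 H4 in
/-- **H2 transports.** -/
theorem H2_shift : ∀ y, y < p → classPoleCount (shift b j) p y = 1 → -(M : ℤ) + 1 ≤ classNu (shift b j) p y := by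
  intro y hy h1
  have hge := classExp_shift_ge b hb.1 hj1 p y
  have hnu := CellA.classExp_le_classNu (shift b j) p y
  have hcb := classPoleCount_shift_le b hb.1 hj1 p y
  by_cases h2 : 2 ≤ classPoleCount b p y
  · have hE := H1 y (mem_filter.2 ⟨mem_range.2 hy, h2⟩)
    by_contra hlt
    have heq : classExp (shift b j) p y = classExp b p y := by omega
    have := classPoleCount_shift_of_classExp_eq b hb.1 hj1 heq
    omega
  · have h1b : classPoleCount b p y = 1 := by omega
    have hnub := H2 y hy h1b
    by_cases heq : classNu b p y = classExp b p y
    · omega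
    · -- tame in `b`, hence tame in `b + e_j`
      have htame : tameSingle b p y = true := by
        by_contra ht
        apply heq
        unfold classNu; rw [if_neg (fun h => ht h.2)]
      have ht' := tameSingle_shift b hb hb' hj1 hj7 h1b (by omega) htame
      unfold classNu; rw [if_pos ⟨h1, ht'⟩]
      exact le_trans (by omega) (le_max_right _ _)

omit hp5 hM H2 H4 in
/-- **H3 transports** (a deep class of `b + e_j` is an unhit deep class of `b`). -/
theorem H3_shift : ∀ x ∈ multipoleClasses (shift b j) p, classExp (shift b j) p x = -(M : ℤ) →
    ¬ CentreIn (shift b j) p x ∧ classTypeList (shift b j) p x = T := by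
  intro x hx hE
  obtain ⟨hxr, h2⟩ := mem_filter.1 hx
  have hxp := mem_range.1 hxr
  have h2b : 2 ≤ classPoleCount b p x := le_trans h2 (classPoleCount_shift_le b hb.1 hj1 p x)
  have hEb := H1 x (mem_filter.2 ⟨hxr, h2b⟩)
  have hge := classExp_shift_ge b hb.1 hj1 p x
  have heq : classExp (shift b j) p x = classExp b p x := by omega
  obtain ⟨hc, htl⟩ := H3 x (mem_filter.2 ⟨hxr, h2b⟩) (by omega)
  refine ⟨fun h => hc ((centreIn_shift b hj1 p x).1 h), ?_⟩
  rw [classTypeList_shift_of_unhit b hb hb' hj1 hj7 heq (le_b0_of_lt b hpn hxp)]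
  exact htl

omit hp5 in
/-- **H4 transports** (REPORT-gen2-g10 §2.3: an unhit sub-deep class keeps its type; a hit deep class becomes a single raise of `T`). -/
theorem H4_shift : ∀ y, y < p → 1 ≤ classPoleCount (shift b j) p y → classNu (shift b j) p y = -(M : ℤ) + 1 →
    isRaise T (classTypeList (shift b j) p y) = true ∨
      (¬ (2 : ℤ) ∣ shift b j 0 ∧ CentreIn (shift b j) p y ∧ classTypeList (shift b j) p y = T) := by
  intro y hy h1 hnu
  have hp0 : 0 < p := hp.out.pos
  have hyn : y ≤ (b 0).toNat := le_b0_of_lt b hpn hy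
  have hcb := classPoleCount_shift_le b hb.1 hj1 p y
  have hge := classExp_shift_ge b hb.1 hj1 p y
  -- `ν⁺ = E⁺ = −M+1` (a tame single class has `ν ≥ 0`)
  have hEq : classNu (shift b j) p y = classExp (shift b j) p y := by
    by_contra hne
    have := (tame_of_classNu_ne (shift b j) hne).2; omega
  have hE' : classExp (shift b j) p y = -(M : ℤ) + 1 := by rw [← hEq]; exact hnu
  by_cases heq : classExp (shift b j) p y = classExp b p y
  · -- unhit: everything transports
    have h1b : 1 ≤ classPoleCount b p y := by rw [← classPoleCount_shift_of_classExp_eq b hb.1 hj1 heq]; exact h1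
    have hnub : classNu b p y = -(M : ℤ) + 1 := by
      by_cases hne : classNu b p y = classExp b p y
      · rw [hne, ← heq]; exact hE'
      · exfalso
        obtain ⟨h1b', -⟩ := tame_of_classNu_ne b hne
        have htame : tameSingle b p y = true := by
          by_contra ht; apply hne; unfold classNu; rw [if_neg (fun h => ht h.2)]
        have ht' := tameSingle_shift b hb hb' hj1 hj7 h1b' h1 htame
        have h1' : classPoleCount (shift b j) p y = 1 := by
          rw [classPoleCount_shift_of_classExp_eq b hb.1 hj1 heq]; exact h1b'
        apply (show classNu (shift b j) p y ≠ classExp (shift b j) p y from ?_) hEq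
        intro h
        have : 0 ≤ classNu (shift b j) p y := by unfold classNu; rw [if_pos ⟨h1', ht'⟩]; exact le_max_right _ _
        omega
    rw [classTypeList_shift_of_unhit b hb hb' hj1 hj7 heq hyn, shift_zero b hj1, centreIn_shift b hj1]
    exact H4 y hy h1b hnub
  · -- hit: `y` was deep in `b`
    have hlt : classExp b p y + 1 ≤ classExp (shift b j) p y := by omega
    by_cases h2b : 2 ≤ classPoleCount b p y
    · have hEb := H1 y (mem_filter.2 ⟨mem_range.2 hy, h2b⟩)
      have hEm : classExp b p y = -(M : ℤ) := by omega
      obtain ⟨hc, htl⟩ := H3 y (mem_filter.2 ⟨mem_range.2 hy, h2b⟩) hEm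
      -- exactly one moved point in the class, at some level ℓ₀
      have h2 := two_mul_le_of_shift b hj1 hj7 hb'
      have hsum := classExp_shift_eq b hb hj1 hj7 hb' p y
      have hone : ∑ s ∈ classSet b p y,
          (if s = (b j).toNat ∨ s = (b 0).toNat - (b j).toNat then (1 : ℤ) else 0) = 1 := by omega
      rw [sum_boole] at hone
      have hcard : ((classSet b p y).filter fun s => s = (b j).toNat ∨ s = (b 0).toNat - (b j).toNat).card = 1 := by
        exact_mod_cast hone
      obtain ⟨s₀, hs₀⟩ := card_eq_one.1 hcard
      have hs₀mem : s₀ ∈ (classSet b p y).filter fun s => s = (b j).toNat ∨ s = (b 0).toNat - (b j).toNat := by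
        rw [hs₀]; exact mem_singleton_self _
      obtain ⟨hs₀c, hs₀mv⟩ := mem_filter.1 hs₀mem
      obtain ⟨hL, hL'⟩ := level_bounds' (p := p) b hyn
      set L := topLevel b p y with hLdef
      rw [LevelClass.classSet_level b hy hL hL'] at hs₀c
      obtain ⟨ℓ₀, hℓ₀, rfl⟩ := mem_image.1 hs₀c
      have hℓ₀L : ℓ₀ ≤ L := by have := mem_range.1 hℓ₀; omega
      -- the new exponents along the levels
      have hnew : ∀ ℓ ≤ L, netExp (shift b j) (y + ℓ * p) = raiseAt (fun k => netExp b (y + k * p)) ℓ₀ ℓ := by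
        intro ℓ hℓ
        rw [CellA.netExp_shift_eq b hb.1 hj1 hj7 h2, raiseAt]
        have hmem : y + ℓ * p ∈ classSet b p y := LevelClass.level_mem b hy hL hL' hℓ
        by_cases hℓℓ : ℓ = ℓ₀
        · subst hℓℓ; rw [if_pos hs₀mv, if_pos rfl]
        · have hnot : ¬ (y + ℓ * p = (b j).toNat ∨ y + ℓ * p = (b 0).toNat - (b j).toNat) := by
            intro h
            have : y + ℓ * p ∈ (classSet b p y).filter fun s => s = (b j).toNat ∨ s = (b 0).toNat - (b j).toNat :=
              mem_filter.2 ⟨hmem, h⟩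
            rw [hs₀, mem_singleton] at this
            exact hℓℓ (LevelClass.level_injective hp0 y this)
          rw [if_neg hnot, if_neg hℓℓ, add_zero]
      left
      have htop : topLevel (shift b j) p y = L := by rw [hLdef]; unfold topLevel; rw [shift_zero b hj1]
      have hS : classTypeList (shift b j) p y = (List.range (L + 1)).map (raiseAt (fun k => netExp b (y + k * p)) ℓ₀) := by
        unfold classTypeList
        rw [htop]
        exact List.map_congr_left fun ℓ hℓ => hnew ℓ (by have := List.mem_range.1 hℓ; omega)
      have hT' : T = (List.range (L + 1)).map (fun k => netExp b (y + k * p)) := by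
        rw [← htl]; exact classTypeList_level b hL hL'
      rw [hS, ← mapIdx_range_map, ← hT']
      unfold isRaise
      simp only [Bool.or_eq_true, List.any_eq_true, beq_iff_eq]
      left; left
      refine ⟨ℓ₀, List.mem_range.2 ?_, rfl⟩
      rw [hT']; simp; omega
    · -- a hit single class: tame, contradiction
      exfalso
      have h1b : classPoleCount b p y = 1 := by omega
      have hnub := H2 y hy h1b
      have hne : classNu b p y ≠ classExp b p y := by omega
      have htame : tameSingle b p y = true := by
        by_contra ht; apply hne; unfold classNu; rw [if_neg (fun h => ht h.2)]
      have ht' := tameSingle_shift b hb hb' hj1 hj7 h1b h1 htame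
      have h1' : classPoleCount (shift b j) p y = 1 := by omega
      have : 0 ≤ classNu (shift b j) p y := by unfold classNu; rw [if_pos ⟨h1', ht'⟩]; exact le_max_right _ _
      omega

end Transport

/-! ## §2 The determinant estimate -/

/-- **Second-order collinearity kills two digits**: if `w ≡ −pX`, `v ≡ −pY`, `w' ≡ −pX'`, `v' ≡ −pY' (mod p²)` with integral
`X, Y, X', Y'` and `(X, Y) ≡ α t`, `(X', Y') ≡ α' t (mod p)`, then `‖w'v − wv'‖ ≤ p⁻³`. -/
theorem det_small {w v w' v' X Y X' Y' α α' tW tV : ℚ}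
    (hw : padicNorm p (w + (p : ℚ) * X) ≤ (p : ℚ) ^ (-(2 : ℤ))) (hv : padicNorm p (v + (p : ℚ) * Y) ≤ (p : ℚ) ^ (-(2 : ℤ)))
    (hw' : padicNorm p (w' + (p : ℚ) * X') ≤ (p : ℚ) ^ (-(2 : ℤ))) (hv' : padicNorm p (v' + (p : ℚ) * Y') ≤ (p : ℚ) ^ (-(2 : ℤ)))
    (hX : padicNorm p X ≤ 1) (hY : padicNorm p Y ≤ 1) (hX' : padicNorm p X' ≤ 1) (hY' : padicNorm p Y' ≤ 1)
    (hXa : padicNorm p (X - α * tW) ≤ (p : ℚ) ^ (-(1 : ℤ))) (hYa : padicNorm p (Y - α * tV) ≤ (p : ℚ) ^ (-(1 : ℤ)))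
    (hXa' : padicNorm p (X' - α' * tW) ≤ (p : ℚ) ^ (-(1 : ℤ))) (hYa' : padicNorm p (Y' - α' * tV) ≤ (p : ℚ) ^ (-(1 : ℤ))) :
    padicNorm p (w' * v - w * v') ≤ (p : ℚ) ^ (-(3 : ℤ)) := by
  have hpQ : (p : ℚ) ≠ 0 := Nat.cast_ne_zero.2 hp.out.ne_zero
  have hp1 : (1 : ℚ) ≤ p := one_le_p
  have hpn : padicNorm p (p : ℚ) = (p : ℚ) ^ (-(1 : ℤ)) := CellA.padicNorm_p
  -- abbreviations for the small quantities
  set r₁ := w + (p : ℚ) * X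
  set r₂ := v + (p : ℚ) * Y
  set r₃ := w' + (p : ℚ) * X'
  set r₄ := v' + (p : ℚ) * Y'
  set e₁ := X - α * tW
  set e₂ := Y - α * tV
  set e₃ := X' - α' * tW
  set e₄ := Y' - α' * tV
  -- the determinant of the directions vanishes identically
  have hdet : X' * Y - X * Y' = (X' - e₃) * e₂ + e₃ * (Y - e₂) + e₃ * e₂ - (X - e₁) * e₄ - e₁ * (Y' - e₄) - e₁ * e₄ := by
    simp only [e₁, e₂, e₃, e₄]; ring
  have hu : ∀ {Z e : ℚ}, padicNorm p Z ≤ 1 → padicNorm p e ≤ (p : ℚ) ^ (-(1 : ℤ)) → padicNorm p (Z - e) ≤ 1 :=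
    fun hZ he => (padicNorm.sub (p := p)).trans (max_le hZ (he.trans (zpow_le_one_of_nonpos₀ hp1 (by norm_num))))
  have hprod1 : ∀ {a c : ℚ}, padicNorm p a ≤ 1 → padicNorm p c ≤ (p : ℚ) ^ (-(1 : ℤ)) →
      padicNorm p (a * c) ≤ (p : ℚ) ^ (-(1 : ℤ)) := fun ha hc => by
    rw [padicNorm.mul]
    calc _ ≤ (1 : ℚ) * (p : ℚ) ^ (-(1 : ℤ)) := mul_le_mul ha hc (padicNorm.nonneg _) zero_le_one
      _ = _ := one_mul _
  have hprod1' : ∀ {a c : ℚ}, padicNorm p a ≤ (p : ℚ) ^ (-(1 : ℤ)) → padicNorm p c ≤ 1 →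
      padicNorm p (a * c) ≤ (p : ℚ) ^ (-(1 : ℤ)) := fun ha hc => by rw [mul_comm]; exact hprod1 hc ha
  have hee : ∀ {a c : ℚ}, padicNorm p a ≤ (p : ℚ) ^ (-(1 : ℤ)) → padicNorm p c ≤ (p : ℚ) ^ (-(1 : ℤ)) →
      padicNorm p (a * c) ≤ (p : ℚ) ^ (-(1 : ℤ)) := fun ha hc =>
    hprod1 (ha.trans (zpow_le_one_of_nonpos₀ hp1 (by norm_num))) hc
  have hD : padicNorm p (X' * Y - X * Y') ≤ (p : ℚ) ^ (-(1 : ℤ)) := by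
    rw [hdet]
    have k1 := hprod1 (hu hX' hXa') hYa
    have k2 := hprod1' hXa' (hu hY hYa)
    have k3 := hee hXa' hYa
    have k4 := hprod1 (hu hX hXa) hYa'
    have k5 := hprod1' hXa (hu hY' hYa')
    have k6 := hee hXa hYa'
    have s2 := (padicNorm.nonarchimedean (p := p)).trans (max_le k1 k2)
    have s3 := (padicNorm.nonarchimedean (p := p)).trans (max_le s2 k3)
    have s4 := (padicNorm.sub (p := p)).trans (max_le s3 k4)
    have s5 := (padicNorm.sub (p := p)).trans (max_le s4 k5)
    exact (padicNorm.sub (p := p)).trans (max_le s5 k6)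
  -- the expansion of the minor
  have hexp : w' * v - w * v' = (p : ℚ) ^ 2 * (X' * Y - X * Y') + (r₃ * r₂ - r₁ * r₄)
      + (p : ℚ) * (-(r₃ * Y) - X' * r₂ + r₁ * Y' + X * r₄) := by
    simp only [r₁, r₂, r₃, r₄]; ring
  have h2le : ∀ {a c : ℚ}, padicNorm p a ≤ (p : ℚ) ^ (-(2 : ℤ)) → padicNorm p c ≤ 1 →
      padicNorm p (a * c) ≤ (p : ℚ) ^ (-(2 : ℤ)) := fun ha hc => by
    rw [padicNorm.mul]
    calc _ ≤ (p : ℚ) ^ (-(2 : ℤ)) * 1 := mul_le_mul ha hc (padicNorm.nonneg _) (zpow_p_nonneg _)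
      _ = _ := mul_one _
  have h2le' : ∀ {a c : ℚ}, padicNorm p a ≤ 1 → padicNorm p c ≤ (p : ℚ) ^ (-(2 : ℤ)) →
      padicNorm p (a * c) ≤ (p : ℚ) ^ (-(2 : ℤ)) := fun ha hc => by rw [mul_comm]; exact h2le hc ha
  have hrr : ∀ {a c : ℚ}, padicNorm p a ≤ (p : ℚ) ^ (-(2 : ℤ)) → padicNorm p c ≤ (p : ℚ) ^ (-(2 : ℤ)) →
      padicNorm p (a * c) ≤ (p : ℚ) ^ (-(3 : ℤ)) := fun ha hc => by
    rw [padicNorm.mul]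
    calc _ ≤ (p : ℚ) ^ (-(2 : ℤ)) * (p : ℚ) ^ (-(2 : ℤ)) := mul_le_mul ha hc (padicNorm.nonneg _) (zpow_p_nonneg _)
      _ = (p : ℚ) ^ (-(4 : ℤ)) := by rw [← zpow_add₀ hpQ]; norm_num
      _ ≤ _ := zpow_le_zpow_right₀ hp1 (by norm_num)
  have t1 : padicNorm p ((p : ℚ) ^ 2 * (X' * Y - X * Y')) ≤ (p : ℚ) ^ (-(3 : ℤ)) := by
    rw [padicNorm.mul, CellA.padicNorm_pow_eq, hpn]
    calc _ ≤ ((p : ℚ) ^ (-(1 : ℤ))) ^ 2 * (p : ℚ) ^ (-(1 : ℤ)) := mul_le_mul_of_nonneg_left hD (by positivity)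
      _ = (p : ℚ) ^ (-(3 : ℤ)) := by rw [← zpow_natCast, ← zpow_mul, ← zpow_add₀ hpQ]; norm_num
  have t2 : padicNorm p (r₃ * r₂ - r₁ * r₄) ≤ (p : ℚ) ^ (-(3 : ℤ)) :=
    (padicNorm.sub (p := p)).trans (max_le (hrr hw' hv) (hrr hw hv'))
  have hin : padicNorm p (-(r₃ * Y) - X' * r₂ + r₁ * Y' + X * r₄) ≤ (p : ℚ) ^ (-(2 : ℤ)) := by
    have k1 : padicNorm p (-(r₃ * Y)) ≤ (p : ℚ) ^ (-(2 : ℤ)) := by rw [padicNorm.neg]; exact h2le hw' hY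
    have k2 := h2le' hX' hv
    have k3 := h2le hw hY'
    have k4 := h2le' hX hv'
    have s2 := (padicNorm.sub (p := p)).trans (max_le k1 k2)
    have s3 := (padicNorm.nonarchimedean (p := p)).trans (max_le s2 k3)
    exact (padicNorm.nonarchimedean (p := p)).trans (max_le s3 k4)
  have t3 : padicNorm p ((p : ℚ) * (-(r₃ * Y) - X' * r₂ + r₁ * Y' + X * r₄)) ≤ (p : ℚ) ^ (-(3 : ℤ)) := by
    rw [padicNorm.mul, hpn]
    calc _ ≤ (p : ℚ) ^ (-(1 : ℤ)) * (p : ℚ) ^ (-(2 : ℤ)) := mul_le_mul_of_nonneg_left hin (zpow_p_nonneg _)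
      _ = _ := by rw [← zpow_add₀ hpQ]; norm_num
  rw [hexp]
  have s2 := (padicNorm.nonarchimedean (p := p)).trans (max_le t1 t2)
  exact (padicNorm.nonarchimedean (p := p)).trans (max_le s2 t3)

/-! ## §3 THEOREM A‴ -/

/-- **THEOREM A‴ (`LawA3`, gen-2 g10) is a theorem.** -/
theorem lawA3_holds : LawA3 := by
  intro b p j M T hb hb' hj1 hj7 hprime hp5 hpb hwin hM hMe hT H1 H2 H3 H4 hcas
  haveI : Fact p.Prime := ⟨hprime⟩
  have hp0 : (p : ℚ) ≠ 0 := Nat.cast_ne_zero.2 hprime.ne_zero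
  have hpneg : (-(p : ℚ)) ≠ 0 := neg_ne_zero.2 hp0
  -- the aggregates for `b` and `b + e_j`
  obtain ⟨α, X, Y, hX1, hY1, hW, hV, hXa, hYa⟩ := aggregate b hb hp5 hpb hwin hM hMe hT H1 H2 H3 H4
  have hpb' : (p : ℤ) ≤ shift b j 0 := by rw [shift_zero b hj1]; exact hpb
  have hwin' : (shift b j 0 + 2 : ℤ) < (p : ℤ) ^ 2 := by rw [shift_zero b hj1]; exact hwin
  have H4' := H4_shift b hb hb' hj1 hj7 hpb hM H1 H2 H3 H4
  obtain ⟨α', X', Y', hX1', hY1', hW', hV', hXa', hYa'⟩ := aggregate (shift b j) hb' hp5 hpb' hwin' hM hMe hT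
    (H1_shift b hb hj1 H1) (H2_shift b hb hb' hj1 hj7 hM H1 H2) (H3_shift b hb hb' hj1 hj7 hpb H1 H3) H4'
  -- the minor
  set w := coeffW b / (-(p : ℚ)) ^ (-(M : ℤ) + 3)
  set v := coeffV b / (-(p : ℚ)) ^ (-(M : ℤ))
  set w' := coeffW (shift b j) / (-(p : ℚ)) ^ (-(M : ℤ) + 3)
  set v' := coeffV (shift b j) / (-(p : ℚ)) ^ (-(M : ℤ))
  have hdet := det_small hW hV hW' hV' hX1 hY1 hX1' hY1' hXa hYa hXa' hYa'
  have hcasE : casoratian b j = (-(p : ℚ)) ^ (-(M : ℤ) + 3) * (-(p : ℚ)) ^ (-(M : ℤ)) * (w' * v - w * v') := by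
    have e1 : coeffW b = w * (-(p : ℚ)) ^ (-(M : ℤ) + 3) := by
      simp only [w]; rw [div_mul_cancel₀ _ (zpow_ne_zero _ hpneg)]
    have e2 : coeffV b = v * (-(p : ℚ)) ^ (-(M : ℤ)) := by
      simp only [v]; rw [div_mul_cancel₀ _ (zpow_ne_zero _ hpneg)]
    have e3 : coeffW (shift b j) = w' * (-(p : ℚ)) ^ (-(M : ℤ) + 3) := by
      simp only [w']; rw [div_mul_cancel₀ _ (zpow_ne_zero _ hpneg)]
    have e4 : coeffV (shift b j) = v' * (-(p : ℚ)) ^ (-(M : ℤ)) := by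
      simp only [v']; rw [div_mul_cancel₀ _ (zpow_ne_zero _ hpneg)]
    unfold casoratian
    rw [e1, e2, e3, e4]; ring
  apply val_ge_of_padicNorm_le hcas
  rw [hcasE, padicNorm.mul, padicNorm.mul, LevelClass.padicNorm_neg_p_zpow, LevelClass.padicNorm_neg_p_zpow]
  calc (p : ℚ) ^ (-(-(M : ℤ) + 3)) * (p : ℚ) ^ (-(-(M : ℤ))) * padicNorm p (w' * v - w * v')
      ≤ (p : ℚ) ^ (-(-(M : ℤ) + 3)) * (p : ℚ) ^ (-(-(M : ℤ))) * (p : ℚ) ^ (-(3 : ℤ)) :=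
        mul_le_mul_of_nonneg_left hdet (mul_nonneg (zpow_p_nonneg _) (zpow_p_nonneg _))
    _ = (p : ℚ) ^ (-((6 : ℤ) - 2 * M)) := by
        rw [← zpow_add₀ hp0, ← zpow_add₀ hp0]; congr 1; ring

end Summit.KontsevichZagierPeriods.Zeta5Search.SecondOrder

end
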